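import Literature.NumberTheory.CubicFields.ThreeTorsionBridge
import HarnessLib

/-!
# BTT Thm 1.2 (`btt_threeTorsion_sum`) = the CFT dictionary `#Cl₃(D) = 2·#{cubic fields of disc D} + 1`
  + the two-term count (3) of cubic fields of fundamental discriminant: the decomposition

Librarian fact-decomposition (libsplit-27, 2026-08-16) of the capped named fact
`Literature.NumberTheory.QuadraticFields.btt_threeTorsion_sum` (`ThreeTorsionMean.lean`:
Bhargava–Taniguchi–Thorne, Math. Ann. 389 (2024) = arXiv:2107.12819 [BTT], **Thm 1.2**, both
signs, secondary coefficients existential). BTT p. 3: "Theorem 1.2 may be viewed as a counting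
theorem for cubic fields whose discriminant is fundamental. Indeed, as subgroups of `Cl(ℚ(√D))` of
index `3` are in bijection with cubic fields of discriminant `D` (see, e.g. [BST]), Theorem 1.2 is
equivalent to (3): `N^±_{3,fund}(X) = (C^±/(2π²)) X + K^± (4ζ(1/3)/(5Γ(2/3)³)) Π_p(1 − (p^{1/3}+1)/(p(p+1))) X^{5/6}
+ O(X^{2/3+ε})`", and §5 (end): "we obtain error terms of `O(X^{2/3+ε})` in Theorem 1.1 and in (3),
which is equivalent to Theorem 1.2". Accordingly the printed proof of Thm 1.2 has exactly two
pieces, vendored here as the two children of the fact (named facts, `def … : Prop`, not proved):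

* `threeTorsion_eq_two_mul_cubicFieldCountOfDisc_add_one` — the class-field-theoretic dictionary
  (Hasse 1930; Davenport–Heilbronn 1971; BST §8.5: "by class field theory the number of triplets of
  cubic fields `K₃` corresponding to a given `K₂` in this way equals `(h₃*(K₂) − 1)/2`", with
  `Disc K₃ = Disc K₂`): for every fundamental discriminant `D`,
  `#Cl(ℚ(√D))[3] = 2 · #{cubic fields of discriminant D, up to iso} + 1`, on the tree's genuine
  objects `quadFieldThreeTorsion D` (`ThreeTorsion.lean`) and `cubicFieldCountOfDisc D`
  (`ThreeTorsionBridge.lean`). Its finite-group half `#Cl₃ = 2·#{index-3 subgroups} + 1` is PROVED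
  (`ThreeTorsionProofs.quadFieldThreeTorsion_eq_two_mul_card_index_three_add_one`); the class field
  theory (index-`3` subgroups ↔ unramified `C₃`-extensions of `K₂` ↔ nowhere totally ramified cubic
  fields of discriminant `D`) is the content. (The seat's class-field-theory-free road, Bhargava's
  parametrisation of `Cl(K₂)[3]` by binary cubic forms, `ThreeTorsionParametrization*.lean`, is an
  alternative proof line of this child.)
* `btt_fundCubicFieldCount_sum` — BTT display (3), both signs: the two-term asymptotic with error
  `O_ε(X^{2/3+ε})` for `N^±_{3,fund}(X) = Σ_{0<±D<X, D fund.} cubicFieldCountOfDisc D`, main terms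
  `3/(2π²) X` (`D < 0`, `C⁻ = 3`) and `1/(2π²) X` (`D > 0`, `C⁺ = 1`), secondary coefficient
  existential (weaker than print, as in the parent).

and the assembly `btt_threeTorsion_sum_holds_of : child₁ → child₂ → btt_threeTorsion_sum` is PROVED,
by the seat's equivalences `btt_threeTorsion_sum_neg_iff_fundCubicFieldCount` /
`btt_threeTorsion_sum_pos_iff_fundCubicFieldCount` (`ThreeTorsionBridge.lean`, resting on the proved
count `#{0 < ±D < X fundamental} = (3/π²)X + O(√X)` of `ThreeTorsionMeanProofs.lean`). Neither child
restates the parent: one is an identity of class field theory at each `D`, the other a counting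
theorem for cubic fields (proved in [BTT] §5 through binary cubic forms, Shintani zeta functions and
the sieve over `q² ∣ Disc` with the uniformity estimate Prop. 4.5 = the tree's `btt_uniformity_sqDvd`).

## References

* M. Bhargava, T. Taniguchi, F. Thorne, *Improved error estimates for the Davenport–Heilbronn
  theorems*, Math. Ann. 389 (2024) = arXiv:2107.12819: Thm 1.2, display (3) and the sentence before
  it (p. 3), §5 (proof of (3)). [BhargavaTaniguchiThorne2023]
* M. Bhargava, A. Shankar, J. Tsimerman, *On the Davenport–Heilbronn theorems and second order
  terms*, Invent. Math. 193 (2013) 439–499 = arXiv:1005.0672: §8.1 (nowhere totally ramified cubic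
  fields ↔ unramified `K₆/K₂`), §8.5 (`(h₃*(K₂) − 1)/2` cubic fields per `K₂`, class field theory).
  [BhargavaShankarTsimerman2012]
* H. Davenport, H. Heilbronn, *On the density of discriminants of cubic fields. II*, Proc. Roy.
  Soc. London A 322 (1971) 405–420, §6 (the class-field-theoretic transfer). [DavenportHeilbronn1971]
* H. Hasse, *Arithmetische Theorie der kubischen Zahlkörper auf klassenkörpertheoretischer
  Grundlage*, Math. Z. 31 (1930) 565–582 (original source of the dictionary; context).
-/

noncomputable section

open Finset

namespace Literature.NumberTheory.CubicFields

open Literature.NumberTheory.QuadraticFields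

/-- **The class-field-theoretic dictionary `#Cl(ℚ(√D))[3] = 2 · #{cubic fields of discriminant D} + 1`
(NAMED FACT, not proved here; Hasse 1930, Davenport–Heilbronn 1971 §6, BST §8.5).** Printed (BST
§8.5): "given a nowhere totally ramified cubic field `K₃`, … in the Galois closure `K₆` is contained a
quadratic field `K₂` and `K₆/K₂` is unramified. In addition, the discriminant of `K₂` is equal to the
discriminant of `K₃`. Furthermore, by class field theory the number of triplets of cubic fields `K₃`
corresponding to a given `K₂` in this way equals `(h₃*(K₂) − 1)/2`, where `h₃*(K₂)` denotes the
number of `3`-torsion elements in the class group of `K₂`"; BTT p. 3: "subgroups of `Cl(ℚ(√D))` of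
index `3` are in bijection with cubic fields of discriminant `D`". Tree form: for every FUNDAMENTAL
discriminant `D` (spelled as in `FundamentalDiscriminant.lean` / `negFundDiscrs`: `D ≡ 1 (4)`
squarefree `≠ 1`, or `D = 4d`, `d ≡ 2, 3 (4)` squarefree),
`quadFieldThreeTorsion D = 2 * cubicFieldCountOfDisc D + 1`, where `quadFieldThreeTorsion D = #Cl(K)[3]`
for the quadratic field `K` of discriminant `D` (`quadFieldThreeTorsion_eq`) and
`cubicFieldCountOfDisc D` is the number of isomorphism classes of cubic number fields of
discriminant exactly `D` (a cubic field of fundamental discriminant is an `S₃`-field nowhere totally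
ramified with quadratic resolvent `ℚ(√D)`: `Disc K₃ = Disc K₂ · f²`, `f` the product of the totally
ramified primes). The group-theoretic half (`#Cl₃ = 2·#{index-3 subgroups} + 1`) is proved in
`ThreeTorsionProofs.lean`; the class field theory is the content. First child of the decomposition
of `btt_threeTorsion_sum`.
[cite: BhargavaShankarTsimerman2012, §8.5 with §8.1 (class field theory: (h₃*(K₂) − 1)/2 cubic fields per quadratic field)] -/
def threeTorsion_eq_two_mul_cubicFieldCountOfDisc_add_one : Prop :=
  ∀ D : ℤ, ((D % 4 = 1 ∧ Squarefree D ∧ D ≠ 1) ∨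
      (4 ∣ D ∧ (D / 4 % 4 = 2 ∨ D / 4 % 4 = 3) ∧ Squarefree (D / 4))) →
    quadFieldThreeTorsion D = 2 * cubicFieldCountOfDisc D + 1

/-- **Bhargava–Taniguchi–Thorne 2023, display (3): the two-term count of cubic fields of
fundamental discriminant (NAMED FACT, not proved here).** Printed (p. 3, proved in §5):
"`N^±_{3,fund}(X) = (C^±/(2π²)) X + K^± (4ζ(1/3)/(5Γ(2/3)³)) Π_p (1 − (p^{1/3}+1)/(p(p+1))) X^{5/6}
+ O(X^{2/3+ε})`, where `N^±_{3,fund}(X)` denotes the number of isomorphism classes of cubic fields `F`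
such that `Disc(F)` is fundamental and `0 < ±Disc(F) < X`" (`C⁺ = 1`, `C⁻ = 3`, `K⁺ = 1`,
`K⁻ = √3`). Tree form, both signs, along `X ∈ ℕ`, with
`N^±_{3,fund}(X) = Σ_{D ∈ negFundDiscrs X / posFundDiscrs X} cubicFieldCountOfDisc D` and the
secondary coefficient EXISTENTIAL (weaker than print, exactly as in `btt_threeTorsion_sum`): there is
`K` such that for every `ε > 0`, `|N⁻_{3,fund}(X) − 3/(2π²) X − K X^{5/6}| ≤ C_ε X^{2/3+ε}` for
`X ≥ 1`, and likewise `N⁺_{3,fund}` with `1/(2π²)`. Second child of the decomposition of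
`btt_threeTorsion_sum`. [cite: BhargavaTaniguchiThorne2023, display (3) p. 3 (proved in §5)] -/
def btt_fundCubicFieldCount_sum : Prop :=
  (∃ K : ℝ, ∀ ε : ℝ, 0 < ε → ∃ C : ℝ, ∀ X : ℕ, 1 ≤ X →
    |(∑ D ∈ negFundDiscrs X, (cubicFieldCountOfDisc D : ℝ)) - 3 / (2 * Real.pi ^ 2) * X
        - K * (X : ℝ) ^ ((5 : ℝ) / 6)| ≤ C * (X : ℝ) ^ ((2 : ℝ) / 3 + ε)) ∧
  (∃ K : ℝ, ∀ ε : ℝ, 0 < ε → ∃ C : ℝ, ∀ X : ℕ, 1 ≤ X →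
    |(∑ D ∈ posFundDiscrs X, (cubicFieldCountOfDisc D : ℝ)) - 1 / (2 * Real.pi ^ 2) * X
        - K * (X : ℝ) ^ ((5 : ℝ) / 6)| ≤ C * (X : ℝ) ^ ((2 : ℝ) / 3 + ε))

/-- **Assembly of the decomposition ("Theorem 1.2 is equivalent to (3)", BTT p. 3)**: the CFT
dictionary and the two-term count (3) of cubic fields of fundamental discriminant give
`btt_threeTorsion_sum` (BTT Thm 1.2), through the seat's proved equivalences
`btt_threeTorsion_sum_neg_iff_fundCubicFieldCount` / `…_pos_iff_…` (bookkeeping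
`Σ #Cl₃ = 2 Σ c + #{fund. D}` with the proved count `#{0 < ±D < X fund.} = (3/π²)X + O(√X)`).
[cite: BhargavaTaniguchiThorne2023, p. 3 (Thm 1.2 ⟺ (3))] -/
theorem btt_threeTorsion_sum_holds_of (h₁ : threeTorsion_eq_two_mul_cubicFieldCountOfDisc_add_one)
    (h₂ : btt_fundCubicFieldCount_sum) : btt_threeTorsion_sum :=
  ⟨(btt_threeTorsion_sum_neg_iff_fundCubicFieldCount
      (fun _ D hD => h₁ D (mem_negFundDiscrs.1 hD).2)).2 h₂.1,
    (btt_threeTorsion_sum_pos_iff_fundCubicFieldCount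
      (fun _ D hD => h₁ D (mem_posFundDiscrs.1 hD).2)).2 h₂.2⟩

end Literature.NumberTheory.CubicFields

end
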